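import Summits.KontsevichZagierPeriods.Zeta5Search.Barrier.ConeGammaCuspSlopeConvexityWalls
import Summits.KontsevichZagierPeriods.Zeta5Search.Barrier.ConeGammaTranslateTangentConeOrbit

/-!
# ζ(5) search — BARRIER: THE CONVEXITY TYPE OF THE CUSP SLOPE AT THE CLOSED ORBIT — convex ⟺ subadditive ⟺ the maximum
# of all chamber functionals; a subadditive cusp with no ascent direction is flat (file (3) of «CONVEXITY TYPE»)

HONEST FRAMING (cell `pub-zeta5`): systematic search; no irrationality claim unless kernel-certified. MODEL objects
under Brown–Zudilin's (28)+(30) accounting ([BZ22] = arXiv:2210.03391; (28) observed, not proved); nothing here is a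
statement about `ζ(5)`, any `γ` of record, the cone's supremum (C2 OPEN) or the value / sign / convexity type of the cusp slope
at a named direction (DATA of the cell: P2 g30's desk saw `σ(δ+δ') ≥ σ(δ)+σ(δ')` on 39 of 44 random pairs at the directions of
record and junctions of both types — NOT used); NO cancellation is quantified; S-E / (TD_A) stay CONJECTURED; records in print
UNMOVED. Prover P2 g44 (item «CONVEXITY TYPE», file (3); plan INBOX 2026-08-28). Sources: files (1) `ConeGammaCuspSlopeConvexityCriterion`,
(2) `ConeGammaCuspSlopeConvexityWalls`, P2 g33 `cuspSlope_eq_greedy_canonical_of_refines` (chamber formula), P2 g28 `cuspSlope_smul`,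
P2 g43 `ConeGammaTranslateTangentConeOrbit` (`differentiableAt_cuspSlope_zero_iff_additive`), P2 g23 `cuspSlope_nonpos_of_isLocalMax`.

SETTING as in file (1). At the closed orbit `δ = 0` all 28 rates tie, every generic `δ₀` refines `0`, and the references refining
the lexicographic order of `(0, Δ)` are the generic references refining `Δ`, whose functional at `Δ` is `σ(Δ)` (P2 g33). So file
(1)'s criterion reads, with no modularity hypothesis (P2 g31 had the ⇐ directions from «`F` submodular / supermodular»):
* **`convexOn_univ_cuspSlope_iff_greedy_le`** — `σ` is convex on `ℝ⁸` iff `Σ_k W_k(δ₀)·φ_k(Δ)/h_k(a) ≤ σ(Δ)` for EVERY generic `δ₀`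
  and every `Δ` (σ is the MAXIMUM of ALL its chamber functionals); **`convexOn_cuspSlope_nhds_zero_iff_univ`** — convex near `0`
  iff convex on `ℝ⁸` (conic structure); **`convexOn_univ_cuspSlope_iff_subadditive`** — iff `σ(Δ + Δ') ≤ σ(Δ) + σ(Δ')` for all
  `Δ, Δ'`; the concave / minimum / superadditive twins;
* **`convexOn_and_concaveOn_univ_cuspSlope_iff_additive`**, `…_iff_differentiableAt_zero` — both types iff `σ` is additive iff
  `σ` is differentiable at the origin (P2 g43 (4));
* **`cuspSlope_eq_zero_of_subadditive_of_forall_nonpos`** — a SUBADDITIVE cusp slope with no ascent direction (`σ ≤ 0`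
  everywhere) is `≡ 0`; hence **`cuspSlope_eq_zero_of_subadditive_of_isLocalMax_gamma`** (P2 g23's hypotheses verbatim): a
  Regular open-box local maximiser of the MODEL `γ` with `Q > 0` at which `σ` is subadditive is CUSP-FREE — P2 g31's theorem with
  «`F` submodular» replaced by its exact consequence for `σ`; the superadditive / `σ ≥ 0` twin.
File (4) `ConeGammaTranslateConvexity` (the translate integral `P`) continues.
NOT here (honest): whether `σ` is sub- or superadditive at any named direction (DATA); `Φ`, `γ` of record, C2, S-E, `ζ(5)`.
-/

noncomputable section

open Set Finset Filter
open scoped Topology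

namespace Summit.KontsevichZagierPeriods.Zeta5Search.Barrier.ConeGamma

/-! ### References at the closed orbit -/

/-- At the closed orbit every reference refines `0` (all rates of `0` vanish: the condition is vacuous). -/
theorem refines_zero (a : Dir) (δ₀ : Fin 8 → ℝ) :
    ∀ k l : Fin 28, phiForm (0 : Fin 8 → ℝ) k / h28 a k < phiForm (0 : Fin 8 → ℝ) l / h28 a l →
      phiForm δ₀ k / h28 a k < phiForm δ₀ l / h28 a l := by
  intro k l h
  rw [phiForm_zero, phiForm_zero, zero_div, zero_div] at h
  exact absurd h (lt_irrefl _)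

/-- At the closed orbit, a reference refining `Δ` refines the lexicographic order of `(0, Δ)`. -/
theorem refines_lex_zero_of_refines {a : Dir} {Δ δ₀ : Fin 8 → ℝ}
    (href : ∀ k l : Fin 28, phiForm Δ k / h28 a k < phiForm Δ l / h28 a l →
      phiForm δ₀ k / h28 a k < phiForm δ₀ l / h28 a l) :
    ∀ k l : Fin 28, (phiForm (0 : Fin 8 → ℝ) k / h28 a k < phiForm (0 : Fin 8 → ℝ) l / h28 a l ∨
        (phiForm (0 : Fin 8 → ℝ) k / h28 a k = phiForm (0 : Fin 8 → ℝ) l / h28 a l ∧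
          phiForm Δ k / h28 a k < phiForm Δ l / h28 a l)) →
      phiForm δ₀ k / h28 a k < phiForm δ₀ l / h28 a l :=
  fun k l h => h.elim (fun h' => refines_zero a δ₀ k l h') fun h' => href k l h'.2

/-! ### Convex ⟺ the maximum of all chamber functionals ⟺ subadditive -/

/-- **IF `σ` IS CONVEX NEAR THE CLOSED ORBIT, EVERY CHAMBER FUNCTIONAL UNDER-ESTIMATES `σ` EVERYWHERE.** All 28 forms of `a`
positive, `T > 0` a period, `F` the canonical period pattern function: if `σ` is convex on some neighbourhood of `0`, then
`Σ_k W_k(δ₀)·φ_k(Δ)/h_k(a) ≤ cuspSlope a T Δ` for every generic `δ₀` and every `Δ` (file (1) at `δ = 0`; P2 g33's chamber formula at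
a reference refining `Δ`). -/
theorem greedy_le_cuspSlope_of_convexOn_nhds_zero {a : Dir} (hpos : ∀ k, 0 < h28 a k) {T : ℝ} (hT : 0 < T)
    (hper : ∀ k : Fin 28, ∃ z : ℤ, T * h28 a k = z) {F : Finset (Fin 28) → ℝ}
    (hF : ∀ A, F A = ∑ m ∈ Finset.range ((bkpts a T).card - 1), ((patternN a (bkpt a T m) A : ℤ) : ℝ))
    (hconv : ∃ U ∈ 𝓝 (0 : Fin 8 → ℝ), ConvexOn ℝ U (cuspSlope a T))
    {δ₀ : Fin 8 → ℝ} (hgen : ∀ k l : Fin 28, k ≠ l → phiForm δ₀ k / h28 a k ≠ phiForm δ₀ l / h28 a l)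
    (Δ : Fin 8 → ℝ) :
    ∑ k, (F (Finset.univ.filter fun l => phiForm δ₀ k / h28 a k ≤ phiForm δ₀ l / h28 a l) -
        F (Finset.univ.filter fun l => phiForm δ₀ k / h28 a k < phiForm δ₀ l / h28 a l)) *
      (phiForm Δ k / h28 a k) ≤ cuspSlope a T Δ := by
  obtain ⟨δ₁, hgen₁, href₁⟩ := exists_generic_refines hpos Δ
  rw [cuspSlope_eq_greedy_canonical_of_refines hpos hT hper hF hgen₁ Δ href₁]
  exact (convexOn_cuspSlope_nhds_iff hpos hT hper hF 0).mp hconv Δ δ₁ δ₀ hgen₁ hgen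
    (refines_lex_zero_of_refines href₁) (refines_zero a δ₀)

/-- **IF EVERY CHAMBER FUNCTIONAL UNDER-ESTIMATES `σ`, THEN `σ` IS CONVEX ON `ℝ⁸`** (`σ` is then the maximum of finitely many
linear functionals: at each point the functional of a refining reference is attained, P2 g33). -/
theorem convexOn_univ_cuspSlope_of_greedy_le {a : Dir} (hpos : ∀ k, 0 < h28 a k) {T : ℝ} (hT : 0 < T)
    (hper : ∀ k : Fin 28, ∃ z : ℤ, T * h28 a k = z) {F : Finset (Fin 28) → ℝ}
    (hF : ∀ A, F A = ∑ m ∈ Finset.range ((bkpts a T).card - 1), ((patternN a (bkpt a T m) A : ℤ) : ℝ))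
    (hle : ∀ δ₀ : Fin 8 → ℝ, (∀ k l : Fin 28, k ≠ l → phiForm δ₀ k / h28 a k ≠ phiForm δ₀ l / h28 a l) →
      ∀ Δ : Fin 8 → ℝ,
        ∑ k, (F (Finset.univ.filter fun l => phiForm δ₀ k / h28 a k ≤ phiForm δ₀ l / h28 a l) -
            F (Finset.univ.filter fun l => phiForm δ₀ k / h28 a k < phiForm δ₀ l / h28 a l)) *
          (phiForm Δ k / h28 a k) ≤ cuspSlope a T Δ) :
    ConvexOn ℝ Set.univ (cuspSlope a T) := by
  refine ⟨convex_univ, fun x _ y _ p q hp hq hpq => ?_⟩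
  obtain ⟨δz, hgz, hrz⟩ := exists_generic_refines hpos (p • x + q • y)
  obtain ⟨Lz, hLz⟩ := exists_clm_greedy a fun k =>
    F (Finset.univ.filter fun l => phiForm δz k / h28 a k ≤ phiForm δz l / h28 a l) -
      F (Finset.univ.filter fun l => phiForm δz k / h28 a k < phiForm δz l / h28 a l)
  have h1 := hle δz hgz x
  have h2 := hle δz hgz y
  rw [← hLz] at h1 h2
  rw [cuspSlope_eq_greedy_canonical_of_refines hpos hT hper hF hgz _ hrz, ← hLz, map_add, map_smul, map_smul,
    smul_eq_mul, smul_eq_mul, smul_eq_mul, smul_eq_mul]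
  exact add_le_add (mul_le_mul_of_nonneg_left h1 hp) (mul_le_mul_of_nonneg_left h2 hq)

/-- **`σ` IS CONVEX ON `ℝ⁸` IFF IT IS THE MAXIMUM OF ALL ITS CHAMBER FUNCTIONALS**: `ConvexOn ℝ univ σ` iff
`Σ_k W_k(δ₀)·φ_k(Δ)/h_k(a) ≤ σ(Δ)` for every generic `δ₀` and every `Δ` (P2 g31 proved ⇐ from «`F` submodular»; here an iff with
no hypothesis on `F`). -/
theorem convexOn_univ_cuspSlope_iff_greedy_le {a : Dir} (hpos : ∀ k, 0 < h28 a k) {T : ℝ} (hT : 0 < T)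
    (hper : ∀ k : Fin 28, ∃ z : ℤ, T * h28 a k = z) {F : Finset (Fin 28) → ℝ}
    (hF : ∀ A, F A = ∑ m ∈ Finset.range ((bkpts a T).card - 1), ((patternN a (bkpt a T m) A : ℤ) : ℝ)) :
    ConvexOn ℝ Set.univ (cuspSlope a T) ↔
      ∀ δ₀ : Fin 8 → ℝ, (∀ k l : Fin 28, k ≠ l → phiForm δ₀ k / h28 a k ≠ phiForm δ₀ l / h28 a l) →
        ∀ Δ : Fin 8 → ℝ,
          ∑ k, (F (Finset.univ.filter fun l => phiForm δ₀ k / h28 a k ≤ phiForm δ₀ l / h28 a l) -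
              F (Finset.univ.filter fun l => phiForm δ₀ k / h28 a k < phiForm δ₀ l / h28 a l)) *
            (phiForm Δ k / h28 a k) ≤ cuspSlope a T Δ :=
  ⟨fun h _ hgen Δ => greedy_le_cuspSlope_of_convexOn_nhds_zero hpos hT hper hF ⟨Set.univ, Filter.univ_mem, h⟩ hgen Δ,
    convexOn_univ_cuspSlope_of_greedy_le hpos hT hper hF⟩

/-- **CONVEX NEAR THE CLOSED ORBIT IFF CONVEX ON `ℝ⁸`** (`σ` is positively homogeneous: its convexity type at `0` is global). -/
theorem convexOn_cuspSlope_nhds_zero_iff_univ {a : Dir} (hpos : ∀ k, 0 < h28 a k) {T : ℝ} (hT : 0 < T)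
    (hper : ∀ k : Fin 28, ∃ z : ℤ, T * h28 a k = z) :
    (∃ U ∈ 𝓝 (0 : Fin 8 → ℝ), ConvexOn ℝ U (cuspSlope a T)) ↔ ConvexOn ℝ Set.univ (cuspSlope a T) := by
  classical
  obtain ⟨F, hF⟩ : ∃ F : Finset (Fin 28) → ℝ,
      ∀ A, F A = ∑ m ∈ Finset.range ((bkpts a T).card - 1), ((patternN a (bkpt a T m) A : ℤ) : ℝ) := ⟨_, fun _ => rfl⟩
  exact ⟨fun h => convexOn_univ_cuspSlope_of_greedy_le hpos hT hper hF fun δ₀ hgen Δ =>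
      greedy_le_cuspSlope_of_convexOn_nhds_zero hpos hT hper hF h hgen Δ,
    fun h => ⟨Set.univ, Filter.univ_mem, h⟩⟩

/-- **`σ` IS CONVEX ON `ℝ⁸` IFF IT IS SUBADDITIVE**: `ConvexOn ℝ univ σ ↔ ∀ Δ Δ', σ(Δ + Δ') ≤ σ(Δ) + σ(Δ')` (⇒: the functional of a
reference refining `Δ + Δ'` is additive and under-estimates `σ` at `Δ` and at `Δ'`; ⇐: P2 g28's homogeneity `σ(t•Δ) = t·σ(Δ)`). -/
theorem convexOn_univ_cuspSlope_iff_subadditive {a : Dir} (hpos : ∀ k, 0 < h28 a k) {T : ℝ} (hT : 0 < T)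
    (hper : ∀ k : Fin 28, ∃ z : ℤ, T * h28 a k = z) :
    ConvexOn ℝ Set.univ (cuspSlope a T) ↔
      ∀ Δ Δ' : Fin 8 → ℝ, cuspSlope a T (Δ + Δ') ≤ cuspSlope a T Δ + cuspSlope a T Δ' := by
  classical
  obtain ⟨F, hF⟩ : ∃ F : Finset (Fin 28) → ℝ,
      ∀ A, F A = ∑ m ∈ Finset.range ((bkpts a T).card - 1), ((patternN a (bkpt a T m) A : ℤ) : ℝ) := ⟨_, fun _ => rfl⟩
  constructor
  · intro h Δ Δ'
    rw [convexOn_univ_cuspSlope_iff_greedy_le hpos hT hper hF] at h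
    obtain ⟨δz, hgz, hrz⟩ := exists_generic_refines hpos (Δ + Δ')
    obtain ⟨Lz, hLz⟩ := exists_clm_greedy a fun k =>
      F (Finset.univ.filter fun l => phiForm δz k / h28 a k ≤ phiForm δz l / h28 a l) -
        F (Finset.univ.filter fun l => phiForm δz k / h28 a k < phiForm δz l / h28 a l)
    have h1 := h δz hgz Δ
    have h2 := h δz hgz Δ'
    rw [← hLz] at h1 h2
    rw [cuspSlope_eq_greedy_canonical_of_refines hpos hT hper hF hgz _ hrz, ← hLz, map_add]
    exact add_le_add h1 h2
  · intro h
    refine ⟨convex_univ, fun x _ y _ s t hs ht hst => ?_⟩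
    have hsub := h (s • x) (t • y)
    rcases hs.eq_or_lt with rfl | hs'
    · simp only [zero_smul, zero_add] at hst ⊢
      rw [hst, one_smul, one_smul]
    rcases ht.eq_or_lt with rfl | ht'
    · simp only [zero_smul, add_zero] at hst ⊢
      rw [hst, one_smul, one_smul]
    rw [cuspSlope_smul hpos hT hper x hs', cuspSlope_smul hpos hT hper y ht'] at hsub
    simpa only [smul_eq_mul] using hsub

/-! ### The concave twins -/

/-- **IF `σ` IS CONCAVE NEAR THE CLOSED ORBIT, EVERY CHAMBER FUNCTIONAL OVER-ESTIMATES `σ` EVERYWHERE.** -/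
theorem cuspSlope_le_greedy_of_concaveOn_nhds_zero {a : Dir} (hpos : ∀ k, 0 < h28 a k) {T : ℝ} (hT : 0 < T)
    (hper : ∀ k : Fin 28, ∃ z : ℤ, T * h28 a k = z) {F : Finset (Fin 28) → ℝ}
    (hF : ∀ A, F A = ∑ m ∈ Finset.range ((bkpts a T).card - 1), ((patternN a (bkpt a T m) A : ℤ) : ℝ))
    (hconc : ∃ U ∈ 𝓝 (0 : Fin 8 → ℝ), ConcaveOn ℝ U (cuspSlope a T))
    {δ₀ : Fin 8 → ℝ} (hgen : ∀ k l : Fin 28, k ≠ l → phiForm δ₀ k / h28 a k ≠ phiForm δ₀ l / h28 a l)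
    (Δ : Fin 8 → ℝ) :
    cuspSlope a T Δ ≤ ∑ k, (F (Finset.univ.filter fun l => phiForm δ₀ k / h28 a k ≤ phiForm δ₀ l / h28 a l) -
        F (Finset.univ.filter fun l => phiForm δ₀ k / h28 a k < phiForm δ₀ l / h28 a l)) *
      (phiForm Δ k / h28 a k) := by
  obtain ⟨δ₁, hgen₁, href₁⟩ := exists_generic_refines hpos Δ
  rw [cuspSlope_eq_greedy_canonical_of_refines hpos hT hper hF hgen₁ Δ href₁]
  exact (concaveOn_cuspSlope_nhds_iff hpos hT hper hF 0).mp hconc Δ δ₁ δ₀ hgen₁ hgen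
    (refines_lex_zero_of_refines href₁) (refines_zero a δ₀)

/-- **IF EVERY CHAMBER FUNCTIONAL OVER-ESTIMATES `σ`, THEN `σ` IS CONCAVE ON `ℝ⁸`.** -/
theorem concaveOn_univ_cuspSlope_of_le_greedy {a : Dir} (hpos : ∀ k, 0 < h28 a k) {T : ℝ} (hT : 0 < T)
    (hper : ∀ k : Fin 28, ∃ z : ℤ, T * h28 a k = z) {F : Finset (Fin 28) → ℝ}
    (hF : ∀ A, F A = ∑ m ∈ Finset.range ((bkpts a T).card - 1), ((patternN a (bkpt a T m) A : ℤ) : ℝ))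
    (hge : ∀ δ₀ : Fin 8 → ℝ, (∀ k l : Fin 28, k ≠ l → phiForm δ₀ k / h28 a k ≠ phiForm δ₀ l / h28 a l) →
      ∀ Δ : Fin 8 → ℝ,
        cuspSlope a T Δ ≤ ∑ k, (F (Finset.univ.filter fun l => phiForm δ₀ k / h28 a k ≤ phiForm δ₀ l / h28 a l) -
            F (Finset.univ.filter fun l => phiForm δ₀ k / h28 a k < phiForm δ₀ l / h28 a l)) *
          (phiForm Δ k / h28 a k)) :
    ConcaveOn ℝ Set.univ (cuspSlope a T) := by
  refine ⟨convex_univ, fun x _ y _ p q hp hq hpq => ?_⟩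
  obtain ⟨δz, hgz, hrz⟩ := exists_generic_refines hpos (p • x + q • y)
  obtain ⟨Lz, hLz⟩ := exists_clm_greedy a fun k =>
    F (Finset.univ.filter fun l => phiForm δz k / h28 a k ≤ phiForm δz l / h28 a l) -
      F (Finset.univ.filter fun l => phiForm δz k / h28 a k < phiForm δz l / h28 a l)
  have h1 := hge δz hgz x
  have h2 := hge δz hgz y
  rw [← hLz] at h1 h2
  rw [cuspSlope_eq_greedy_canonical_of_refines hpos hT hper hF hgz _ hrz, ← hLz, map_add, map_smul, map_smul,
    smul_eq_mul, smul_eq_mul, smul_eq_mul, smul_eq_mul]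
  exact add_le_add (mul_le_mul_of_nonneg_left h1 hp) (mul_le_mul_of_nonneg_left h2 hq)

/-- **`σ` IS CONCAVE ON `ℝ⁸` IFF IT IS THE MINIMUM OF ALL ITS CHAMBER FUNCTIONALS** (P2 g31 proved ⇐ from «`F` supermodular»). -/
theorem concaveOn_univ_cuspSlope_iff_le_greedy {a : Dir} (hpos : ∀ k, 0 < h28 a k) {T : ℝ} (hT : 0 < T)
    (hper : ∀ k : Fin 28, ∃ z : ℤ, T * h28 a k = z) {F : Finset (Fin 28) → ℝ}
    (hF : ∀ A, F A = ∑ m ∈ Finset.range ((bkpts a T).card - 1), ((patternN a (bkpt a T m) A : ℤ) : ℝ)) :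
    ConcaveOn ℝ Set.univ (cuspSlope a T) ↔
      ∀ δ₀ : Fin 8 → ℝ, (∀ k l : Fin 28, k ≠ l → phiForm δ₀ k / h28 a k ≠ phiForm δ₀ l / h28 a l) →
        ∀ Δ : Fin 8 → ℝ,
          cuspSlope a T Δ ≤ ∑ k, (F (Finset.univ.filter fun l => phiForm δ₀ k / h28 a k ≤ phiForm δ₀ l / h28 a l) -
              F (Finset.univ.filter fun l => phiForm δ₀ k / h28 a k < phiForm δ₀ l / h28 a l)) *
            (phiForm Δ k / h28 a k) :=
  ⟨fun h _ hgen Δ => cuspSlope_le_greedy_of_concaveOn_nhds_zero hpos hT hper hF ⟨Set.univ, Filter.univ_mem, h⟩ hgen Δ,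
    concaveOn_univ_cuspSlope_of_le_greedy hpos hT hper hF⟩

/-- **CONCAVE NEAR THE CLOSED ORBIT IFF CONCAVE ON `ℝ⁸`.** -/
theorem concaveOn_cuspSlope_nhds_zero_iff_univ {a : Dir} (hpos : ∀ k, 0 < h28 a k) {T : ℝ} (hT : 0 < T)
    (hper : ∀ k : Fin 28, ∃ z : ℤ, T * h28 a k = z) :
    (∃ U ∈ 𝓝 (0 : Fin 8 → ℝ), ConcaveOn ℝ U (cuspSlope a T)) ↔ ConcaveOn ℝ Set.univ (cuspSlope a T) := by
  classical
  obtain ⟨F, hF⟩ : ∃ F : Finset (Fin 28) → ℝ,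
      ∀ A, F A = ∑ m ∈ Finset.range ((bkpts a T).card - 1), ((patternN a (bkpt a T m) A : ℤ) : ℝ) := ⟨_, fun _ => rfl⟩
  exact ⟨fun h => concaveOn_univ_cuspSlope_of_le_greedy hpos hT hper hF fun δ₀ hgen Δ =>
      cuspSlope_le_greedy_of_concaveOn_nhds_zero hpos hT hper hF h hgen Δ,
    fun h => ⟨Set.univ, Filter.univ_mem, h⟩⟩

/-- **`σ` IS CONCAVE ON `ℝ⁸` IFF IT IS SUPERADDITIVE**: `ConcaveOn ℝ univ σ ↔ ∀ Δ Δ', σ(Δ) + σ(Δ') ≤ σ(Δ + Δ')`. -/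
theorem concaveOn_univ_cuspSlope_iff_superadditive {a : Dir} (hpos : ∀ k, 0 < h28 a k) {T : ℝ} (hT : 0 < T)
    (hper : ∀ k : Fin 28, ∃ z : ℤ, T * h28 a k = z) :
    ConcaveOn ℝ Set.univ (cuspSlope a T) ↔
      ∀ Δ Δ' : Fin 8 → ℝ, cuspSlope a T Δ + cuspSlope a T Δ' ≤ cuspSlope a T (Δ + Δ') := by
  classical
  obtain ⟨F, hF⟩ : ∃ F : Finset (Fin 28) → ℝ,
      ∀ A, F A = ∑ m ∈ Finset.range ((bkpts a T).card - 1), ((patternN a (bkpt a T m) A : ℤ) : ℝ) := ⟨_, fun _ => rfl⟩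
  constructor
  · intro h Δ Δ'
    rw [concaveOn_univ_cuspSlope_iff_le_greedy hpos hT hper hF] at h
    obtain ⟨δz, hgz, hrz⟩ := exists_generic_refines hpos (Δ + Δ')
    obtain ⟨Lz, hLz⟩ := exists_clm_greedy a fun k =>
      F (Finset.univ.filter fun l => phiForm δz k / h28 a k ≤ phiForm δz l / h28 a l) -
        F (Finset.univ.filter fun l => phiForm δz k / h28 a k < phiForm δz l / h28 a l)
    have h1 := h δz hgz Δ
    have h2 := h δz hgz Δ'
    rw [← hLz] at h1 h2
    rw [cuspSlope_eq_greedy_canonical_of_refines hpos hT hper hF hgz _ hrz, ← hLz, map_add]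
    exact add_le_add h1 h2
  · intro h
    refine ⟨convex_univ, fun x _ y _ s t hs ht hst => ?_⟩
    have hsup := h (s • x) (t • y)
    rcases hs.eq_or_lt with rfl | hs'
    · simp only [zero_smul, zero_add] at hst ⊢
      rw [hst, one_smul, one_smul]
    rcases ht.eq_or_lt with rfl | ht'
    · simp only [zero_smul, add_zero] at hst ⊢
      rw [hst, one_smul, one_smul]
    rw [cuspSlope_smul hpos hT hper x hs', cuspSlope_smul hpos hT hper y ht'] at hsup
    simpa only [smul_eq_mul] using hsup

/-! ### Both types: additivity; neither ascent nor convexity: flatness -/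

/-- **`σ` IS CONVEX AND CONCAVE ON `ℝ⁸` IFF IT IS ADDITIVE** (`σ(Δ + Δ') = σ(Δ) + σ(Δ')` for all `Δ, Δ'`). -/
theorem convexOn_and_concaveOn_univ_cuspSlope_iff_additive {a : Dir} (hpos : ∀ k, 0 < h28 a k) {T : ℝ} (hT : 0 < T)
    (hper : ∀ k : Fin 28, ∃ z : ℤ, T * h28 a k = z) :
    (ConvexOn ℝ Set.univ (cuspSlope a T) ∧ ConcaveOn ℝ Set.univ (cuspSlope a T)) ↔
      ∀ Δ Δ' : Fin 8 → ℝ, cuspSlope a T (Δ + Δ') = cuspSlope a T Δ + cuspSlope a T Δ' := by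
  rw [convexOn_univ_cuspSlope_iff_subadditive hpos hT hper, concaveOn_univ_cuspSlope_iff_superadditive hpos hT hper]
  exact ⟨fun h Δ Δ' => (h.1 Δ Δ').antisymm (h.2 Δ Δ'), fun h => ⟨fun Δ Δ' => (h Δ Δ').le, fun Δ Δ' => (h Δ Δ').ge⟩⟩

/-- **… IFF `σ` IS DIFFERENTIABLE AT THE ORIGIN** (P2 g43: differentiable at `0` iff additive). -/
theorem convexOn_and_concaveOn_univ_cuspSlope_iff_differentiableAt_zero {a : Dir} (hpos : ∀ k, 0 < h28 a k) {T : ℝ}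
    (hT : 0 < T) (hper : ∀ k : Fin 28, ∃ z : ℤ, T * h28 a k = z) :
    (ConvexOn ℝ Set.univ (cuspSlope a T) ∧ ConcaveOn ℝ Set.univ (cuspSlope a T)) ↔
      DifferentiableAt ℝ (cuspSlope a T) 0 := by
  rw [convexOn_and_concaveOn_univ_cuspSlope_iff_additive hpos hT hper,
    differentiableAt_cuspSlope_zero_iff_additive hpos hT hper]

/-- **A SUBADDITIVE CUSP SLOPE WITH NO ASCENT DIRECTION IS IDENTICALLY ZERO**: if `σ(Δ + Δ') ≤ σ(Δ) + σ(Δ')` for all `Δ, Δ'`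
and `σ ≤ 0` everywhere, then `σ ≡ 0` (`0 = σ(0) ≤ σ(Δ) + σ(−Δ) ≤ σ(Δ) ≤ 0`). P2 g31 had this under «`F` submodular», which
implies subadditivity; here the hypothesis is the exact property of `σ`. -/
theorem cuspSlope_eq_zero_of_subadditive_of_forall_nonpos {a : Dir} {T : ℝ}
    (hsub : ∀ Δ Δ' : Fin 8 → ℝ, cuspSlope a T (Δ + Δ') ≤ cuspSlope a T Δ + cuspSlope a T Δ')
    (hnonpos : ∀ Δ : Fin 8 → ℝ, cuspSlope a T Δ ≤ 0) (Δ : Fin 8 → ℝ) : cuspSlope a T Δ = 0 := by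
  have h1 := hsub Δ (-Δ)
  rw [add_neg_cancel, cuspSlope_zero] at h1
  have h2 := hnonpos Δ
  have h3 := hnonpos (-Δ)
  linarith

/-- **A SUPERADDITIVE CUSP SLOPE WITH NO DESCENT DIRECTION IS IDENTICALLY ZERO** (twin: `σ ≥ 0` everywhere forces `σ ≡ 0`). -/
theorem cuspSlope_eq_zero_of_superadditive_of_forall_nonneg {a : Dir} {T : ℝ}
    (hsup : ∀ Δ Δ' : Fin 8 → ℝ, cuspSlope a T Δ + cuspSlope a T Δ' ≤ cuspSlope a T (Δ + Δ'))
    (hnonneg : ∀ Δ : Fin 8 → ℝ, 0 ≤ cuspSlope a T Δ) (Δ : Fin 8 → ℝ) : cuspSlope a T Δ = 0 := by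
  have h1 := hsup Δ (-Δ)
  rw [add_neg_cancel, cuspSlope_zero] at h1
  have h2 := hnonneg Δ
  have h3 := hnonneg (-Δ)
  linarith

/-- **A LOCALLY CONVEX CUSP SLOPE WITH A LOCAL MAXIMUM AT THE CLOSED ORBIT IS IDENTICALLY ZERO** (file (2)'s flatness at `δ = 0`,
made global by homogeneity: `IsLocalMax σ 0 ↔ σ ≤ 0` everywhere, P2 g43). -/
theorem cuspSlope_eq_zero_of_convexOn_nhds_zero_of_isLocalMax {a : Dir} (hpos : ∀ k, 0 < h28 a k) {T : ℝ} (hT : 0 < T)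
    (hper : ∀ k : Fin 28, ∃ z : ℤ, T * h28 a k = z)
    (hconv : ∃ U ∈ 𝓝 (0 : Fin 8 → ℝ), ConvexOn ℝ U (cuspSlope a T)) (hmax : IsLocalMax (cuspSlope a T) 0)
    (Δ : Fin 8 → ℝ) : cuspSlope a T Δ = 0 :=
  cuspSlope_eq_zero_of_subadditive_of_forall_nonpos
    ((convexOn_univ_cuspSlope_iff_subadditive hpos hT hper).mp
      ((convexOn_cuspSlope_nhds_zero_iff_univ hpos hT hper).mp hconv))
    ((isLocalMax_cuspSlope_zero_iff hpos hT hper).mp hmax) Δ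

/-- **A LOCAL MAXIMISER OF THE MODEL `γ` AT WHICH THE CUSP SLOPE IS SUBADDITIVE IS CUSP-FREE.** At a Regular OPEN-box direction
with a period `T` and `Q = C₁ + δ₂₈ − Φ > 0` which is a local maximiser of the MODEL `γ` (P2 g23's hypotheses of
`cuspSlope_nonpos_of_isLocalMax`, verbatim): if `σ(Δ + Δ') ≤ σ(Δ) + σ(Δ')` for all `Δ, Δ'` (equivalently `σ` convex on `ℝ⁸`,
equivalently convex near `0`), then `cuspSlope a T Δ = 0` for EVERY `Δ`. Whether `σ` is subadditive at a named lattice point is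
DATA; no instance is asserted. -/
theorem cuspSlope_eq_zero_of_subadditive_of_isLocalMax_gamma {a : Dir}
    (hopen : ∀ j : Fin 7, 0 < sParam a j.succ ∧ sParam a j.succ < sParam a 0)
    {T : ℝ} (hT : 0 < T) (hper : ∀ k : Fin 28, ∃ z : ℤ, T * h28 a k = z)
    (hQ : 0 < C1 a + delta28 a - phi30 a) (hreg : Regular a) (hmax : IsLocalMax gamma a)
    (hsub : ∀ Δ Δ' : Fin 8 → ℝ, cuspSlope a T (Δ + Δ') ≤ cuspSlope a T Δ + cuspSlope a T Δ') (Δ : Fin 8 → ℝ) :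
    cuspSlope a T Δ = 0 :=
  cuspSlope_eq_zero_of_subadditive_of_forall_nonpos hsub
    (fun Δ' => cuspSlope_nonpos_of_isLocalMax hopen hT hper Δ' hQ hreg hmax) Δ

end Summit.KontsevichZagierPeriods.Zeta5Search.Barrier.ConeGamma

end
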